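import Mathlib.Algebra.Order.Round
import Mathlib.Analysis.SpecialFunctions.Pow.Real
import Mathlib.Analysis.SpecialFunctions.Trigonometric.Basic
import HarnessLib

/-!
# Constants of the finite-volume sector propagator bounds: the integer tangent approximant and the scaling arithmetic

Topic `MathematicalPhysics/QuantumLattice`; the elementary half of `TorusSectorPropagatorDecay.lean` (Benfatto–Giuliani–
Mastropietro 2006, Lemma 2.2 at finite `(β, L)`), kept apart so that the model file stays one topic.  At scale
`h = -n` (`γ = 4`, `x = 4ⁿ = γ^{-h}`, `y = 2ⁿ = γ^{-h/2}`, `x = y²`) the lattice decay bounds are taken along FIVE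
directions — the time step, the two axes, and an INTEGER approximant `v` of the scaled tangent `2ⁿτ(θ_{n,ω})` together
with its rotation `v⊥` — and the resulting constants are products of powers of `x, y` which must cancel exactly
against the phase-space count.  PROVED here:

* **`exists_int_frame_approx`** — rounding `Rτ` for a unit vector `τ` and `R ≥ 1` gives an integer `v ≠ 0` with
  `|⟨τ,v⟩ - R| ≤ 1`, `|τ₂v₁ - τ₁v₂| ≤ 1`, `R/2 ≤ |v|`, `|v₁|+|v₂| ≤ 2R+1`;
* `abs_le_one_of_sq_add_sq`, the five direction costs `dirCost_time/_axis_fst/_axis_snd/_perp/_tan`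
  (`x|w₀| + x|⟨n,w⃗⟩| + y|⟨τ,w⃗⟩|` for the five steps: `x h₀`, `≤ 2x hₓ`, `≤ 2x hₓ`, `≤ 3xy hₓ`, `≤ 3x hₓ`);
* `inv_pow_mul_mul_pow`, **`count_scaling_le`** (the phase-space count `(e₀x⁻¹β/π+3)(√2LC₁x⁻¹/π+2)(√2LC₂y⁻¹/π+2)
  ≤ D₀ βL² x⁻²y⁻¹` above the temperature scale), `timeFactor_le`, `nearFactor_le`, `farFactor_le`,
  `seam_threshold_lt`, `nearRadius_threshold_lt` — the volume factors `≍ x`, `≍ xy`, `≍ xy` and the two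
  largeness thresholds in `L`.

Everything is proved; no definitions, no named facts. [folklore]

## Sources

G. Benfatto, A. Giuliani, V. Mastropietro, Ann. Henri Poincaré 7 (2006) 809–898, §2.5 Lemma 2.2, §2.6 (2.81) and
footnote ¹ (`BenfattoGiulianiMastropietro2006`).  Routine ("folklore").
-/

noncomputable section

namespace Literature.MathematicalPhysics.QuantumLattice

open Finset
open scoped Real

/-! ### An integer approximant of the scaled tangent direction -/

/-- **Rounding the scaled tangent**: for a unit vector `τ` and `R ≥ 1` there is an integer vector `v ≠ 0` with
`|⟨τ, v⟩ - R| ≤ 1`, `|τ₂v₁ - τ₁v₂| ≤ 1` (the component along the normal `n = (τ₂, -τ₁)`), `R/2 ≤ |v|`, and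
`|v₁| + |v₂| ≤ 2R + 1`. [folklore] -/
theorem exists_int_frame_approx (τ : Fin 2 → ℝ) (hτ : τ 0 ^ 2 + τ 1 ^ 2 = 1) {R : ℝ} (hR : 1 ≤ R) :
    ∃ v : Fin 2 → ℤ, v ≠ 0 ∧ |τ 0 * (v 0 : ℝ) + τ 1 * (v 1 : ℝ) - R| ≤ 1 ∧ |τ 1 * (v 0 : ℝ) - τ 0 * (v 1 : ℝ)| ≤ 1 ∧
      R / 2 ≤ Real.sqrt ((v 0 : ℝ) ^ 2 + (v 1 : ℝ) ^ 2) ∧ |(v 0 : ℝ)| + |(v 1 : ℝ)| ≤ 2 * R + 1 := by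
  set v : Fin 2 → ℤ := fun j => round (R * τ j) with hv
  have hd : ∀ j, |((v j : ℤ) : ℝ) - R * τ j| ≤ 1 / 2 := fun j => by
    rw [abs_sub_comm]; exact abs_sub_round (R * τ j)
  have hτ0 : |τ 0| ≤ 1 := by
    rw [← Real.sqrt_sq_eq_abs, ← Real.sqrt_one]; exact Real.sqrt_le_sqrt (by nlinarith [sq_nonneg (τ 1)])
  have hτ1 : |τ 1| ≤ 1 := by
    rw [← Real.sqrt_sq_eq_abs, ← Real.sqrt_one]; exact Real.sqrt_le_sqrt (by nlinarith [sq_nonneg (τ 0)])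
  set d0 : ℝ := ((v 0 : ℤ) : ℝ) - R * τ 0 with hd0
  set d1 : ℝ := ((v 1 : ℤ) : ℝ) - R * τ 1 with hd1
  have hd0' : |d0| ≤ 1 / 2 := hd 0
  have hd1' : |d1| ≤ 1 / 2 := hd 1
  have e0 : ((v 0 : ℤ) : ℝ) = R * τ 0 + d0 := by rw [hd0]; ring
  have e1 : ((v 1 : ℤ) : ℝ) = R * τ 1 + d1 := by rw [hd1]; ring
  -- the tangential and normal components
  have htan : τ 0 * (v 0 : ℝ) + τ 1 * (v 1 : ℝ) - R = τ 0 * d0 + τ 1 * d1 := by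
    rw [e0, e1]; linear_combination R * hτ
  have hnor : τ 1 * (v 0 : ℝ) - τ 0 * (v 1 : ℝ) = τ 1 * d0 - τ 0 * d1 := by rw [e0, e1]; ring
  have h1 : |τ 0 * d0 + τ 1 * d1| ≤ 1 := by
    calc |τ 0 * d0 + τ 1 * d1| ≤ |τ 0 * d0| + |τ 1 * d1| := abs_add_le _ _
      _ = |τ 0| * |d0| + |τ 1| * |d1| := by rw [abs_mul, abs_mul]
      _ ≤ 1 * (1 / 2) + 1 * (1 / 2) := add_le_add (mul_le_mul hτ0 hd0' (abs_nonneg _) zero_le_one)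
          (mul_le_mul hτ1 hd1' (abs_nonneg _) zero_le_one)
      _ = 1 := by norm_num
  have h2 : |τ 1 * d0 - τ 0 * d1| ≤ 1 := by
    calc |τ 1 * d0 - τ 0 * d1| ≤ |τ 1 * d0| + |τ 0 * d1| := abs_sub _ _
      _ = |τ 1| * |d0| + |τ 0| * |d1| := by rw [abs_mul, abs_mul]
      _ ≤ 1 * (1 / 2) + 1 * (1 / 2) := add_le_add (mul_le_mul hτ1 hd0' (abs_nonneg _) zero_le_one)
          (mul_le_mul hτ0 hd1' (abs_nonneg _) zero_le_one)
      _ = 1 := by norm_num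
  -- `v ≠ 0`
  have hv0 : v ≠ 0 := by
    intro h
    have h0 : ((v 0 : ℤ) : ℝ) = 0 := by rw [h]; simp
    have h1' : ((v 1 : ℤ) : ℝ) = 0 := by rw [h]; simp
    have hd0z : d0 = -(R * τ 0) := by rw [hd0, h0]; ring
    have hd1z : d1 = -(R * τ 1) := by rw [hd1, h1']; ring
    have ha : |R * τ 0| ≤ 1 / 2 := by rw [← abs_neg, ← hd0z]; exact hd0'
    have hb : |R * τ 1| ≤ 1 / 2 := by rw [← abs_neg, ← hd1z]; exact hd1'
    have ha2 : (R * τ 0) ^ 2 ≤ 1 / 4 := by nlinarith [abs_nonneg (R * τ 0), sq_abs (R * τ 0)]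
    have hb2 : (R * τ 1) ^ 2 ≤ 1 / 4 := by nlinarith [abs_nonneg (R * τ 1), sq_abs (R * τ 1)]
    have hq : (R * τ 0) ^ 2 + (R * τ 1) ^ 2 = R ^ 2 := by linear_combination R ^ 2 * hτ
    nlinarith
  -- the length
  have hint : (1 : ℝ) ≤ (v 0 : ℝ) ^ 2 + (v 1 : ℝ) ^ 2 := by
    have hz : v 0 ≠ 0 ∨ v 1 ≠ 0 := by
      by_contra h
      push Not at h
      exact hv0 (funext fun j => by fin_cases j <;> simp [h.1, h.2])
    rcases hz with h | h
    · have h' : (1 : ℤ) ≤ (v 0) ^ 2 := by nlinarith [Int.one_le_abs h, sq_abs (v 0)]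
      have h'' : (1 : ℝ) ≤ (v 0 : ℝ) ^ 2 := by exact_mod_cast h'
      nlinarith [sq_nonneg (v 1 : ℝ)]
    · have h' : (1 : ℤ) ≤ (v 1) ^ 2 := by nlinarith [Int.one_le_abs h, sq_abs (v 1)]
      have h'' : (1 : ℝ) ≤ (v 1 : ℝ) ^ 2 := by exact_mod_cast h'
      nlinarith [sq_nonneg (v 0 : ℝ)]
  have hCS : (τ 0 * (v 0 : ℝ) + τ 1 * (v 1 : ℝ)) ^ 2 ≤ (v 0 : ℝ) ^ 2 + (v 1 : ℝ) ^ 2 := by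
    nlinarith [sq_nonneg (τ 0 * (v 1 : ℝ) - τ 1 * (v 0 : ℝ))]
  have hge : R - 1 ≤ τ 0 * (v 0 : ℝ) + τ 1 * (v 1 : ℝ) := by
    have h := (abs_le.1 h1).1
    linarith [htan]
  have hlen : R / 2 ≤ Real.sqrt ((v 0 : ℝ) ^ 2 + (v 1 : ℝ) ^ 2) := by
    rw [Real.le_sqrt (by linarith) (by positivity)]
    by_cases hR2 : 2 ≤ R
    · have h3 : 0 ≤ R - 1 := by linarith
      have h4 : (R - 1) ^ 2 ≤ (τ 0 * (v 0 : ℝ) + τ 1 * (v 1 : ℝ)) ^ 2 := pow_le_pow_left₀ h3 hge 2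
      nlinarith
    · push Not at hR2
      nlinarith
  refine ⟨v, hv0, by rw [htan]; exact h1, by rw [hnor]; exact h2, hlen, ?_⟩
  have ha := abs_le.1 hd0'
  have hb := abs_le.1 hd1'
  have hR0 : 0 ≤ R := by linarith
  have hRt0 : |R * τ 0| ≤ R := by
    rw [abs_mul, abs_of_nonneg hR0]; exact mul_le_of_le_one_right hR0 hτ0
  have hRt1 : |R * τ 1| ≤ R := by
    rw [abs_mul, abs_of_nonneg hR0]; exact mul_le_of_le_one_right hR0 hτ1
  calc |(v 0 : ℝ)| + |(v 1 : ℝ)| = |R * τ 0 + d0| + |R * τ 1 + d1| := by rw [e0, e1]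
    _ ≤ (|R * τ 0| + |d0|) + (|R * τ 1| + |d1|) := add_le_add (abs_add_le _ _) (abs_add_le _ _)
    _ ≤ (R + 1 / 2) + (R + 1 / 2) := by linarith
    _ = 2 * R + 1 := by ring

/-! ### Real arithmetic of the constants -/

section Arith

/-- `a² + b² = 1 ⟹ |a| ≤ 1 ∧ |b| ≤ 1`. [folklore] -/
theorem abs_le_one_of_sq_add_sq {a b : ℝ} (h : a ^ 2 + b ^ 2 = 1) : |a| ≤ 1 ∧ |b| ≤ 1 := by
  constructor
  · rw [← Real.sqrt_sq_eq_abs, ← Real.sqrt_one]; exact Real.sqrt_le_sqrt (by nlinarith [sq_nonneg b])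
  · rw [← Real.sqrt_sq_eq_abs, ← Real.sqrt_one]; exact Real.sqrt_le_sqrt (by nlinarith [sq_nonneg a])

/-- The direction costs.  Time: `x|h₀| + x|0| + y|0| = x h₀`. [folklore] -/
theorem dirCost_time {x y h₀ n0 n1 t0 t1 : ℝ} (hh : 0 ≤ h₀) :
    x * |h₀| + x * |n0 * ((0 : Fin 2 → ℝ) 0) + n1 * ((0 : Fin 2 → ℝ) 1)| +
      y * |t0 * ((0 : Fin 2 → ℝ) 0) + t1 * ((0 : Fin 2 → ℝ) 1)| = x * h₀ := by
  simp [abs_of_nonneg hh]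

/-- Axis `e₁`: cost `≤ 2 x hₓ` (`|n₀|, |τ₀| ≤ 1`, `y ≤ x`). [folklore] -/
theorem dirCost_axis_fst {x y hx n0 n1 t0 t1 : ℝ} (hx0 : 0 ≤ hx) (hxpos : 0 ≤ x) (hyx : y ≤ x) (hy : 0 ≤ y)
    (hn : |n0| ≤ 1) (ht : |t0| ≤ 1) :
    x * |(0 : ℝ)| + x * |n0 * (hx * (((![1, 0] : Fin 2 → ℤ) 0 : ℤ) : ℝ)) + n1 * (hx * (((![1, 0] : Fin 2 → ℤ) 1 : ℤ) : ℝ))| +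
      y * |t0 * (hx * (((![1, 0] : Fin 2 → ℤ) 0 : ℤ) : ℝ)) + t1 * (hx * (((![1, 0] : Fin 2 → ℤ) 1 : ℤ) : ℝ))| ≤ 2 * x * hx := by
  simp only [Matrix.cons_val_zero, Matrix.cons_val_one, Int.cast_one, Int.cast_zero, mul_one, mul_zero, add_zero,
    abs_zero]
  rw [abs_mul, abs_mul, abs_of_nonneg hx0]
  nlinarith [mul_le_mul_of_nonneg_left hn (mul_nonneg hxpos hx0), mul_le_mul_of_nonneg_left ht (mul_nonneg hy hx0),
    mul_le_mul_of_nonneg_right hyx hx0]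

/-- Axis `e₂`: cost `≤ 2 x hₓ`. [folklore] -/
theorem dirCost_axis_snd {x y hx n0 n1 t0 t1 : ℝ} (hx0 : 0 ≤ hx) (hxpos : 0 ≤ x) (hyx : y ≤ x) (hy : 0 ≤ y)
    (hn : |n1| ≤ 1) (ht : |t1| ≤ 1) :
    x * |(0 : ℝ)| + x * |n0 * (hx * (((![0, 1] : Fin 2 → ℤ) 0 : ℤ) : ℝ)) + n1 * (hx * (((![0, 1] : Fin 2 → ℤ) 1 : ℤ) : ℝ))| +
      y * |t0 * (hx * (((![0, 1] : Fin 2 → ℤ) 0 : ℤ) : ℝ)) + t1 * (hx * (((![0, 1] : Fin 2 → ℤ) 1 : ℤ) : ℝ))| ≤ 2 * x * hx := by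
  simp only [Matrix.cons_val_zero, Matrix.cons_val_one, Int.cast_one, Int.cast_zero, mul_one, mul_zero, zero_add,
    abs_zero]
  rw [abs_mul, abs_mul, abs_of_nonneg hx0]
  nlinarith [mul_le_mul_of_nonneg_left hn (mul_nonneg hxpos hx0), mul_le_mul_of_nonneg_left ht (mul_nonneg hy hx0),
    mul_le_mul_of_nonneg_right hyx hx0]

/-- The rotated approximant `v⊥ = (-v₂, v₁)`: cost `≤ 3 x y hₓ` (normal = rotated tangent, `|⟨τ,v⟩| ≤ y + 1`,
`|τ₂v₁ - τ₁v₂| ≤ 1`, `1 ≤ y ≤ x`). [folklore] -/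
theorem dirCost_perp {x y hx t0 t1 : ℝ} {v0 v1 : ℤ} (hx0 : 0 ≤ hx) (hxpos : 0 ≤ x) (hyx : y ≤ x) (hy : 1 ≤ y)
    (hvt : |t0 * (v0 : ℝ) + t1 * (v1 : ℝ)| ≤ y + 1) (hvn : |t1 * (v0 : ℝ) - t0 * (v1 : ℝ)| ≤ 1) :
    x * |(0 : ℝ)| + x * |t1 * (hx * (((![-v1, v0] : Fin 2 → ℤ) 0 : ℤ) : ℝ)) + -t0 * (hx * (((![-v1, v0] : Fin 2 → ℤ) 1 : ℤ) : ℝ))| +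
      y * |t0 * (hx * (((![-v1, v0] : Fin 2 → ℤ) 0 : ℤ) : ℝ)) + t1 * (hx * (((![-v1, v0] : Fin 2 → ℤ) 1 : ℤ) : ℝ))| ≤
      3 * x * y * hx := by
  simp only [Matrix.cons_val_zero, Matrix.cons_val_one, Int.cast_neg, abs_zero, mul_zero, zero_add]
  have e1 : t1 * (hx * -(v1 : ℝ)) + -t0 * (hx * (v0 : ℝ)) = -(hx * (t0 * v0 + t1 * v1)) := by ring
  have e2 : t0 * (hx * -(v1 : ℝ)) + t1 * (hx * (v0 : ℝ)) = hx * (t1 * v0 - t0 * v1) := by ring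
  rw [e1, e2, abs_neg, abs_mul, abs_mul, abs_of_nonneg hx0]
  have h1 : x * (hx * |t0 * (v0 : ℝ) + t1 * v1|) ≤ x * (hx * (y + 1)) :=
    mul_le_mul_of_nonneg_left (mul_le_mul_of_nonneg_left hvt hx0) hxpos
  have h2 : y * (hx * |t1 * (v0 : ℝ) - t0 * v1|) ≤ y * (hx * 1) :=
    mul_le_mul_of_nonneg_left (mul_le_mul_of_nonneg_left hvn hx0) (by linarith)
  nlinarith [mul_nonneg hxpos hx0, mul_nonneg (by linarith : (0 : ℝ) ≤ y) hx0,
    mul_le_mul_of_nonneg_right hyx hx0, mul_le_mul_of_nonneg_right hy (mul_nonneg hxpos hx0)]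

/-- The approximant `v`: cost `≤ 3 x hₓ`. [folklore] -/
theorem dirCost_tan {x y hx t0 t1 : ℝ} {v0 v1 : ℤ} (hx0 : 0 ≤ hx) (hxpos : 0 ≤ x) (hyx : y ≤ x) (hy : 1 ≤ y)
    (hxy : x = y ^ 2) (hvt : |t0 * (v0 : ℝ) + t1 * (v1 : ℝ)| ≤ y + 1) (hvn : |t1 * (v0 : ℝ) - t0 * (v1 : ℝ)| ≤ 1) :
    x * |(0 : ℝ)| + x * |t1 * (hx * (v0 : ℝ)) + -t0 * (hx * (v1 : ℝ))| + y * |t0 * (hx * (v0 : ℝ)) + t1 * (hx * (v1 : ℝ))| ≤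
      3 * x * hx := by
  simp only [abs_zero, mul_zero, zero_add]
  have e1 : t1 * (hx * (v0 : ℝ)) + -t0 * (hx * (v1 : ℝ)) = hx * (t1 * v0 - t0 * v1) := by ring
  have e2 : t0 * (hx * (v0 : ℝ)) + t1 * (hx * (v1 : ℝ)) = hx * (t0 * v0 + t1 * v1) := by ring
  rw [e1, e2, abs_mul, abs_mul, abs_of_nonneg hx0]
  have h1 : x * (hx * |t1 * (v0 : ℝ) - t0 * v1|) ≤ x * (hx * 1) :=
    mul_le_mul_of_nonneg_left (mul_le_mul_of_nonneg_left hvn hx0) hxpos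
  have h2 : y * (hx * |t0 * (v0 : ℝ) + t1 * v1|) ≤ y * (hx * (y + 1)) :=
    mul_le_mul_of_nonneg_left (mul_le_mul_of_nonneg_left hvt hx0) (by linarith)
  have h3 : y * (hx * (y + 1)) = hx * (x + y) := by rw [hxy]; ring
  nlinarith [mul_le_mul_of_nonneg_right hyx hx0]

/-- `(b⁻¹)^N (c · b^N) = c` for `b ≠ 0`. [folklore] -/
theorem inv_pow_mul_mul_pow {b c : ℝ} (hb : b ≠ 0) (N : ℕ) : b⁻¹ ^ N * (c * b ^ N) = c := by
  rw [inv_pow, mul_comm c, ← mul_assoc, inv_mul_cancel₀ (pow_ne_zero N hb), one_mul]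

/-- **The phase-space count in the scaling form**: under `3πx ≤ e₀β` and `x, y ≤ L`,
`(e₀x⁻¹β/π + 3)(√2L(C₁x⁻¹)/π + 2)(√2L(C₂y⁻¹)/π + 2) ≤ D₀ βL² x⁻¹x⁻¹y⁻¹`, `D₀ = (2e₀/π)(√2C₁/π+2)(√2C₂/π+2)`. [folklore] -/
theorem count_scaling_le {e₀ β L x y C₁ C₂ : ℝ} (he : 0 < e₀) (hβ : 0 < β) (hx : 0 < x) (hy : 0 < y) (hL : 0 < L)
    (hC₁ : 0 ≤ C₁) (hC₂ : 0 ≤ C₂) (hβx : 3 * π * x ≤ e₀ * β) (hxL : x ≤ L) (hyL : y ≤ L) :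
    (e₀ * x⁻¹ * β / π + 3) * ((Real.sqrt 2 * L * (C₁ * x⁻¹) / π + 2) * (Real.sqrt 2 * L * (C₂ * y⁻¹) / π + 2)) ≤
      (2 * e₀ / π) * ((Real.sqrt 2 * C₁ / π + 2) * (Real.sqrt 2 * C₂ / π + 2)) * (β * L ^ 2) * x⁻¹ * x⁻¹ * y⁻¹ := by
  have hπ := Real.pi_pos
  -- first factor
  have h1 : e₀ * x⁻¹ * β / π + 3 ≤ 2 * (e₀ * x⁻¹ * β / π) := by
    have : 3 ≤ e₀ * x⁻¹ * β / π := by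
      rw [le_div_iff₀ hπ, mul_assoc, mul_comm x⁻¹, ← mul_assoc, ← div_eq_mul_inv, le_div_iff₀ hx]; linarith
    linarith
  have h2 : Real.sqrt 2 * L * (C₁ * x⁻¹) / π + 2 ≤ L * x⁻¹ * (Real.sqrt 2 * C₁ / π + 2) := by
    have : (1 : ℝ) ≤ L * x⁻¹ := by rw [← div_eq_mul_inv, one_le_div hx]; exact hxL
    have e : L * x⁻¹ * (Real.sqrt 2 * C₁ / π + 2) = Real.sqrt 2 * L * (C₁ * x⁻¹) / π + 2 * (L * x⁻¹) := by ring
    rw [e]; linarith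
  have h3 : Real.sqrt 2 * L * (C₂ * y⁻¹) / π + 2 ≤ L * y⁻¹ * (Real.sqrt 2 * C₂ / π + 2) := by
    have : (1 : ℝ) ≤ L * y⁻¹ := by rw [← div_eq_mul_inv, one_le_div hy]; exact hyL
    have e : L * y⁻¹ * (Real.sqrt 2 * C₂ / π + 2) = Real.sqrt 2 * L * (C₂ * y⁻¹) / π + 2 * (L * y⁻¹) := by ring
    rw [e]; linarith
  have h0a : 0 ≤ e₀ * x⁻¹ * β / π + 3 := by positivity
  have h0b : 0 ≤ Real.sqrt 2 * L * (C₁ * x⁻¹) / π + 2 := by positivity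
  have h0c : 0 ≤ Real.sqrt 2 * L * (C₂ * y⁻¹) / π + 2 := by positivity
  calc (e₀ * x⁻¹ * β / π + 3) * ((Real.sqrt 2 * L * (C₁ * x⁻¹) / π + 2) * (Real.sqrt 2 * L * (C₂ * y⁻¹) / π + 2))
      ≤ (2 * (e₀ * x⁻¹ * β / π)) * ((L * x⁻¹ * (Real.sqrt 2 * C₁ / π + 2)) * (L * y⁻¹ * (Real.sqrt 2 * C₂ / π + 2))) :=
        mul_le_mul h1 (mul_le_mul h2 h3 h0c (h0b.trans h2)) (mul_nonneg h0b h0c) (h0a.trans h1)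
    _ = (2 * e₀ / π) * ((Real.sqrt 2 * C₁ / π + 2) * (Real.sqrt 2 * C₂ / π + 2)) * (β * L ^ 2) * x⁻¹ * x⁻¹ * y⁻¹ := by ring

/-- The time factor with the time weight: `(β/2M)·32(1/s₀ + 1) ≤ 16(π+1)x` for `s₀ = β/(πxM)`, `β ≤ M`, `1 ≤ x`. [folklore] -/
theorem timeFactor_le {β M x : ℝ} (hβ : 0 < β) (hM : 0 < M) (hβM : β ≤ M) (hx : 1 ≤ x) :
    β / (2 * M) * (32 * (1 / (β / (π * x * M)) + 1)) ≤ 16 * (π + 1) * x := by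
  have hπ := Real.pi_pos
  have e : β / (2 * M) * (32 * (1 / (β / (π * x * M)) + 1)) = 16 * π * x + 16 * (β / M) := by
    field_simp; ring
  rw [e]
  have : β / M ≤ 1 := (div_le_one hM).2 hβM
  nlinarith

/-- The near-region factor: with `s₂|v| ≥ (3πx)⁻¹` and `s₃|v| ≥ (3πy)⁻¹` (`1 ≤ x, y`),
`8(2√2/(s₂|v|)+2)(2√2/(s₃|v|)+2) ≤ 8(6√2π+2)² x y`. [folklore] -/
theorem nearFactor_le {a b x y : ℝ} (hx : 1 ≤ x) (hy : 1 ≤ y) (ha : 0 < a) (hb : 0 < b)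
    (hax : (3 * π * x)⁻¹ ≤ a) (hby : (3 * π * y)⁻¹ ≤ b) :
    8 * ((2 * Real.sqrt 2 / a + 2) * (2 * Real.sqrt 2 / b + 2)) ≤ 8 * (6 * Real.sqrt 2 * π + 2) ^ 2 * (x * y) := by
  have hπ := Real.pi_pos
  have hs := Real.sqrt_nonneg 2
  have h1 : 2 * Real.sqrt 2 / a ≤ 6 * Real.sqrt 2 * π * x := by
    rw [div_le_iff₀ ha]
    have : 1 ≤ a * (3 * π * x) := by
      have h := mul_le_mul_of_nonneg_right hax (by positivity : (0 : ℝ) ≤ 3 * π * x)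
      rwa [inv_mul_cancel₀ (by positivity)] at h
    nlinarith
  have h2 : 2 * Real.sqrt 2 / b ≤ 6 * Real.sqrt 2 * π * y := by
    rw [div_le_iff₀ hb]
    have : 1 ≤ b * (3 * π * y) := by
      have h := mul_le_mul_of_nonneg_right hby (by positivity : (0 : ℝ) ≤ 3 * π * y)
      rwa [inv_mul_cancel₀ (by positivity)] at h
    nlinarith
  have h3 : 2 * Real.sqrt 2 / a + 2 ≤ (6 * Real.sqrt 2 * π + 2) * x := by nlinarith
  have h4 : 2 * Real.sqrt 2 / b + 2 ≤ (6 * Real.sqrt 2 * π + 2) * y := by nlinarith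
  have h0a : 0 ≤ 2 * Real.sqrt 2 / a + 2 := by positivity
  have h0b : 0 ≤ 2 * Real.sqrt 2 / b + 2 := by positivity
  calc 8 * ((2 * Real.sqrt 2 / a + 2) * (2 * Real.sqrt 2 / b + 2))
      ≤ 8 * (((6 * Real.sqrt 2 * π + 2) * x) * ((6 * Real.sqrt 2 * π + 2) * y)) :=
        mul_le_mul_of_nonneg_left (mul_le_mul h3 h4 h0b (h0a.trans h3)) (by norm_num)
    _ = 8 * (6 * Real.sqrt 2 * π + 2) ^ 2 * (x * y) := by ring

/-- The far-region factor with `s₁ = (πx)⁻¹`, `R₀ = 4xy` (`x = y²`, `1 ≤ x,y`, exponent `≥ 1`):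
`(1 + s₁R₀)^{-m}·32(1/s₁+1)² ≤ 8π(π+1)² x y`. [folklore] -/
theorem farFactor_le {x y : ℝ} (hx : 1 ≤ x) (hy : 1 ≤ y) (hxy : x = y ^ 2) {m : ℕ} (hm : 1 ≤ m) :
    (1 + 1 / (π * x) * ((4 * x * y : ℝ)))⁻¹ ^ m * (32 * (1 / (1 / (π * x)) + 1) ^ 2) ≤ 8 * π * (π + 1) ^ 2 * (x * y) := by
  have hπ := Real.pi_pos
  have hxpos : 0 < x := by linarith
  have hypos : 0 < y := by linarith
  have e1 : 1 / (π * x) * (4 * x * y) = 4 * y / π := by field_simp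
  have e2 : 1 / (1 / (π * x)) = π * x := by field_simp
  rw [e1, e2]
  have hbase : (1 + 4 * y / π)⁻¹ ≤ π / (4 * y) := by
    rw [inv_le_comm₀ (by positivity) (by positivity)]
    have : (π / (4 * y))⁻¹ = 4 * y / π := by rw [inv_div]
    rw [this]; linarith
  have hle1 : (1 + 4 * y / π)⁻¹ ≤ 1 := inv_le_one_of_one_le₀ (le_add_of_nonneg_right (by positivity))
  have hpow : (1 + 4 * y / π)⁻¹ ^ m ≤ π / (4 * y) :=
    (pow_le_pow_of_le_one (by positivity) hle1 hm).trans (by rw [pow_one]; exact hbase)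
  have hsq : (π * x + 1) ^ 2 ≤ ((π + 1) * x) ^ 2 := pow_le_pow_left₀ (by positivity) (by nlinarith) 2
  calc (1 + 4 * y / π)⁻¹ ^ m * (32 * (π * x + 1) ^ 2) ≤ (π / (4 * y)) * (32 * ((π + 1) * x) ^ 2) :=
        mul_le_mul hpow (by nlinarith) (by positivity) (by positivity)
    _ = 8 * π * (π + 1) ^ 2 * (x * x / y) := by field_simp; ring
    _ = 8 * π * (π + 1) ^ 2 * (x * y) := by rw [hxy]; field_simp

/-- The zone-seam threshold: `4N(V+1) < L` for `V ≤ 2y + 1`, `1 ≤ y ≤ x`, `64(N+1)x² ≤ L`. [folklore] -/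
theorem seam_threshold_lt {N L x y V : ℝ} (hV : V ≤ 2 * y + 1) (hyx : y ≤ x) (h1y : 1 ≤ y) (hN : 0 ≤ N)
    (hL : 64 * (N + 1) * (x * x) ≤ L) : 4 * N * (V + 1) < L := by
  have hx1 : 1 ≤ x := h1y.trans hyx
  have hNx : 0 ≤ N * x := mul_nonneg hN (by linarith)
  have h1 : 4 * N * (V + 1) ≤ 16 * (N * x) := by nlinarith
  have h2 : 16 * (N * x) ≤ 16 * (N * x) * x := by nlinarith
  have h3 : 16 * (N * x) * x < 64 * (N + 1) * (x * x) := by nlinarith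
  linarith

/-- The near-radius threshold: `2V·(4xy) < L` for `V ≤ 2y + 1`, `x = y²`, `1 ≤ y`, `64(N+1)x² ≤ L`. [folklore] -/
theorem nearRadius_threshold_lt {N L x y V : ℝ} (hV : V ≤ 2 * y + 1) (hxy : x = y ^ 2) (h1y : 1 ≤ y) (hN : 0 ≤ N)
    (hL : 64 * (N + 1) * (x * x) ≤ L) : 2 * V * (4 * (x * y)) < L := by
  have hy0 : 0 ≤ y := by linarith
  have hyx : y ≤ x := by rw [hxy]; nlinarith
  have hx0 : 0 < x := by linarith
  have h1 : 2 * V * (4 * (x * y)) ≤ 2 * (2 * y + 1) * (4 * (x * y)) :=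
    mul_le_mul_of_nonneg_right (by linarith) (by positivity)
  have h2 : 2 * (2 * y + 1) * (4 * (x * y)) ≤ 24 * (x * x) := by nlinarith [mul_le_mul_of_nonneg_left hyx hx0.le]
  have h3 : 24 * (x * x) < 64 * (N + 1) * (x * x) := by nlinarith [mul_pos hx0 hx0]
  linarith

end Arith

end Literature.MathematicalPhysics.QuantumLattice
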